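import Literature.IUT.HodgeTheaters.PiAvatarBaseKitStandIn
import Literature.IUT.HodgeTheaters.PMBaseStripsVpmEqVpmunSchema
import HarnessLib

/-!
# [IUTchI] Remark 6.1.1 "`𝕍^± = 𝕍^{±un}`" (FACT-LIST F-2040 `PMBaseKit.VpmEqVpmun`) AT THE GENUINE §6 BASE KITS
# `InitialThetaData.baseKitStandIn` / `baseKitOfTorsionMonodromy` / `baseKitOfBadPairs` (proof-only)

S. Mochizuki, *Inter-universal Teichmüller theory I*, kurims manuscript (May 2020), §6, Remark 6.1.1 p. 159 ("in the
notation of Example 4.3, (i); Definition 6.1, (v), it is not difficult to verify [cf. Remark 3.1.2, (i)] that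
`𝕍^± = 𝕍^{±un} (⊆ 𝕍(K))`") and Definition 6.1 (v) p. 158 ("`𝕍^± := Aut_±(𝒟^{⊚±}) · 𝕍 ⊆ 𝕍(K)`")
([IUTchI] Rmk 6.1.1 p.159) [claim: Mochizuki2012, status: disputed] (D-0012 claim key; nothing of the series is asserted here).

Cell abc-iut, block F (seat abc-iut-f-193 gen 4), L5-lead F6 row «Rmk611-AT-GENUINE-KIT» (plan/L5/F6-L5-XREF.tsv row F-2040):
FROZEN FACT-LIST row **F-2040** `Literature.IUT.HodgeTheaters.PMBaseKit.VpmEqVpmun` is a SCHEMA over abc-iut-L5-t4's base-kit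
record `PMBaseKit` with the §4 object `𝕍^{±un}` of Example 4.3 (i) as a free PARAMETER `Vpmun : Set VK` (its universal closure is
REFUTED in tree: `PMBaseKit.not_forall_vpmEqVpmun`, abc-iut-f-086; it holds at every kit for exactly one value of the parameter,
`PMBaseKit.vpmEqVpmun_iff` / `vpmEqVpmun_self`).  This PROOF-ONLY companion (no `def`, no `instance`, no new `Prop` fact; the kit
files of abc-iut-L5-t4 / abc-iut-L5-d5 are imported, never edited) records the row's INSTANCE FORMS at the three GENUINE kits built
over abc-iut-L5-t2's real `InitialThetaData`:
* `InitialThetaData.vpmEqVpmun_baseKitStandIn` (+ `_iff`) — at the stand-in kit `baseKitStandIn CG hS M hA hI` (p448457);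
* `InitialThetaData.vpmEqVpmun_baseKitOfTorsionMonodromy` (+ `_iff`) — at the minimally-bound genuine kit (p446463);
* `InitialThetaData.vpmEqVpmun_baseKitOfBadPairs` (+ `_iff`) — at the genuine-shape kit with (L2) discharged (p448457).

HONEST LIMIT (stated, not hidden): Example 4.3 (i)'s `𝕍^{±un}` is NOT a typed object of the tree (abc-iut-L5-t3's §4 files do not
declare it), so the parameter `Vpmun` can only be instantiated at `𝕍^± = Aut_±(𝒟^{⊚±}) · 𝕍` itself; the theorems below are the
instance forms of the schema at the genuine kits (every kit binder of Def. 6.1 discharged but the standing `CG`, `hS`, `M`, `hA`,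
`hI` [, `B`, `ΛBad`]), and their mathematical content is parameter bookkeeping (the `_iff` forms say the parameter is DETERMINED at
each genuine kit).  The printed identification with Example 4.3 (i)'s `𝕍^{±un}` becomes a kernel statement only once that object is
typed (after-merge §4/§6).  Typed ≠ inhabited ≠ proved; no side is taken on [IUTchIII] Cor. 3.12.
-/

namespace Literature.IUT.HodgeTheaters

open CategoryTheory

universe u v w

section VpmEqVpmunAtGenuineKits

variable {F : Type u} {K : Type v} {Fbar : Type w} [Field F] [NumberField F] [Field K] [NumberField K]
  [Algebra F K] [Field Fbar] [Algebra F Fbar] [Algebra K Fbar]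
  {E : WeierstrassCurve F} [E.IsElliptic] {l : ℕ} {Pb : BadPlacePredicates K}
  (D : InitialThetaData F K Fbar E l Pb) (CG : D.geom.pe.CuspGalois) (hS : D.CuspClassesNormaliserStable) [Fact l.Prime]
  (M : D.TorsionMonodromy) (hA : D.geom.pe.ArrowCoveringClaims)
  (hI : ∀ k ∈ D.geom.pe.inertia D.geom.pe.ε1, M.tau (D.geom.embK k) = 0)

namespace InitialThetaData

/-! ### At the stand-in kit `baseKitStandIn` -/

/-- **[IUTchI] Rmk 6.1.1 (F-2040) at the stand-in kit `baseKitStandIn CG hS M hA hI`**: for every ambient `𝕍(K)`-set `VK` with its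
`Aut(𝒟^{⊚±})`-action and every section `𝕍 → 𝕍(K)`, the predicate `VpmEqVpmun` holds at the parameter
`Vpmun := 𝕍^± = Aut_±(𝒟^{⊚±}) · 𝕍` (the only value at which it can hold, `vpmEqVpmun_baseKitStandIn_iff`).
([IUTchI] Rmk 6.1.1 p.159) [claim: Mochizuki2012, status: disputed] -/
theorem vpmEqVpmun_baseKitStandIn (VK : Type*) [MulAction (Aut (D.baseKitStandIn CG hS M hA hI).gModel) VK]
    (sect : (D.baseKitStandIn CG hS M hA hI).V → VK) :
    (D.baseKitStandIn CG hS M hA hI).VpmEqVpmun VK sect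
      {x : VK | ∃ α ∈ (D.baseKitStandIn CG hS M hA hI).autPMg (D.baseKitStandIn CG hS M hA hI).gModel,
        ∃ v, x = α • sect v} :=
  PMBaseKit.vpmEqVpmun_self VK sect

/-- **The parameter is determined at `baseKitStandIn`**: `VpmEqVpmun VK sect Vpmun` holds iff `Vpmun = 𝕍^±`.
([IUTchI] Rmk 6.1.1 p.159) [claim: Mochizuki2012, status: disputed] -/
theorem vpmEqVpmun_baseKitStandIn_iff (VK : Type*) [MulAction (Aut (D.baseKitStandIn CG hS M hA hI).gModel) VK]
    (sect : (D.baseKitStandIn CG hS M hA hI).V → VK) (Vpmun : Set VK) :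
    (D.baseKitStandIn CG hS M hA hI).VpmEqVpmun VK sect Vpmun ↔
      Vpmun = {x : VK | ∃ α ∈ (D.baseKitStandIn CG hS M hA hI).autPMg (D.baseKitStandIn CG hS M hA hI).gModel,
        ∃ v, x = α • sect v} :=
  PMBaseKit.vpmEqVpmun_iff VK sect Vpmun

/-! ### At the minimally-bound genuine kit `baseKitOfTorsionMonodromy` -/

section Genuine

variable (B : ∀ v, v ∈ D.indexCopyBad → D.BadPairAt v)
  (hsign : ∀ v : D.IndexCopy, v ∉ D.indexCopyBad → ∀ n : D.PiC,
    n ∈ Subgroup.normalizer ((D.PiXarrow ⊓ (D.decompAt v).comap D.augGF : Subgroup D.PiC) : Set D.PiC) →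
      ∀ hn : n ∈ Subgroup.normalizer ((D.PiXund : Subgroup D.PiC) : Set D.PiC),
        ∃ ε : ℤˣ, ∀ x, D.gChart₀Model CG (D.actF CG hS ⟨n, hn⟩ x) = ε • D.gChart₀Model CG x)
  (ΛBad : ∀ v (h : v ∈ D.indexCopyBad), D.LocalArrowLaw CG hS (B v h).H)

/-- **[IUTchI] Rmk 6.1.1 (F-2040) at the minimally-bound genuine kit `baseKitOfTorsionMonodromy CG hS M hA hI B hsign ΛBad`**:
`VpmEqVpmun` holds at the parameter `Vpmun := 𝕍^±`. ([IUTchI] Rmk 6.1.1 p.159) [claim: Mochizuki2012, status: disputed] -/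
theorem vpmEqVpmun_baseKitOfTorsionMonodromy (VK : Type*)
    [MulAction (Aut (D.baseKitOfTorsionMonodromy CG hS M hA hI B hsign ΛBad).gModel) VK]
    (sect : (D.baseKitOfTorsionMonodromy CG hS M hA hI B hsign ΛBad).V → VK) :
    (D.baseKitOfTorsionMonodromy CG hS M hA hI B hsign ΛBad).VpmEqVpmun VK sect
      {x : VK | ∃ α ∈ (D.baseKitOfTorsionMonodromy CG hS M hA hI B hsign ΛBad).autPMg
          (D.baseKitOfTorsionMonodromy CG hS M hA hI B hsign ΛBad).gModel,
        ∃ v, x = α • sect v} :=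
  PMBaseKit.vpmEqVpmun_self VK sect

/-- **The parameter is determined at `baseKitOfTorsionMonodromy`**: `VpmEqVpmun VK sect Vpmun ↔ Vpmun = 𝕍^±`.
([IUTchI] Rmk 6.1.1 p.159) [claim: Mochizuki2012, status: disputed] -/
theorem vpmEqVpmun_baseKitOfTorsionMonodromy_iff (VK : Type*)
    [MulAction (Aut (D.baseKitOfTorsionMonodromy CG hS M hA hI B hsign ΛBad).gModel) VK]
    (sect : (D.baseKitOfTorsionMonodromy CG hS M hA hI B hsign ΛBad).V → VK) (Vpmun : Set VK) :
    (D.baseKitOfTorsionMonodromy CG hS M hA hI B hsign ΛBad).VpmEqVpmun VK sect Vpmun ↔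
      Vpmun = {x : VK | ∃ α ∈ (D.baseKitOfTorsionMonodromy CG hS M hA hI B hsign ΛBad).autPMg
          (D.baseKitOfTorsionMonodromy CG hS M hA hI B hsign ΛBad).gModel,
        ∃ v, x = α • sect v} :=
  PMBaseKit.vpmEqVpmun_iff VK sect Vpmun

/-! ### At the genuine-shape kit `baseKitOfBadPairs` ((L2) discharged) -/

/-- **[IUTchI] Rmk 6.1.1 (F-2040) at the genuine-shape kit `baseKitOfBadPairs CG hS M hA hI B ΛBad`** ((L2) discharged by
abc-iut-L5-d5's `localArrowLaw_L2_sign_local`): `VpmEqVpmun` holds at the parameter `Vpmun := 𝕍^±`.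
([IUTchI] Rmk 6.1.1 p.159) [claim: Mochizuki2012, status: disputed] -/
theorem vpmEqVpmun_baseKitOfBadPairs (VK : Type*) [MulAction (Aut (D.baseKitOfBadPairs CG hS M hA hI B ΛBad).gModel) VK]
    (sect : (D.baseKitOfBadPairs CG hS M hA hI B ΛBad).V → VK) :
    (D.baseKitOfBadPairs CG hS M hA hI B ΛBad).VpmEqVpmun VK sect
      {x : VK | ∃ α ∈ (D.baseKitOfBadPairs CG hS M hA hI B ΛBad).autPMg (D.baseKitOfBadPairs CG hS M hA hI B ΛBad).gModel,
        ∃ v, x = α • sect v} :=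
  PMBaseKit.vpmEqVpmun_self VK sect

/-- **The parameter is determined at `baseKitOfBadPairs`**: `VpmEqVpmun VK sect Vpmun ↔ Vpmun = 𝕍^±`.
([IUTchI] Rmk 6.1.1 p.159) [claim: Mochizuki2012, status: disputed] -/
theorem vpmEqVpmun_baseKitOfBadPairs_iff (VK : Type*) [MulAction (Aut (D.baseKitOfBadPairs CG hS M hA hI B ΛBad).gModel) VK]
    (sect : (D.baseKitOfBadPairs CG hS M hA hI B ΛBad).V → VK) (Vpmun : Set VK) :
    (D.baseKitOfBadPairs CG hS M hA hI B ΛBad).VpmEqVpmun VK sect Vpmun ↔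
      Vpmun = {x : VK | ∃ α ∈ (D.baseKitOfBadPairs CG hS M hA hI B ΛBad).autPMg (D.baseKitOfBadPairs CG hS M hA hI B ΛBad).gModel,
        ∃ v, x = α • sect v} :=
  PMBaseKit.vpmEqVpmun_iff VK sect Vpmun

end Genuine

end InitialThetaData

end VpmEqVpmunAtGenuineKits

end Literature.IUT.HodgeTheaters
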